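import Mathlib
import Literature.NumberTheory.Automorphic.AdelicGLnGlue
import Literature.NumberTheory.Automorphic.ArchimedeanExpChart
import HarnessLib

/-!
# Automorphic forms are smooth in the matrix coordinates of `G_∞` —
crux HeckeEigenvalueField (stmt-Langlands-13632), line Sketch, stub DICT-W4

Statement.  Let `K` be a number field, `K_∞ = mixedSpace K = ℝ^{r₁} × ℂ^{r₂}`,
`M = M_n(K_∞)` (operator norm, scope `Matrix.Norms.Operator`) and `G_∞ = GL_n(K_∞)` the archimedean
group of the automorphy datum `AutomorphyDatum.gl n K hcpt` (the full linear real group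
`archGroupGL n K = RealMatrixGroup.gl (mixedSpace K) (Fin n)`, Lie algebra all of `M`), embedded in
`GL_n(𝔸_K)` by `ofArch`.  Read a matrix `m ∈ M` in `G_∞` through
`u m = if h : IsUnit m then ⟨h.unit, _⟩ else 1`.  For `φ : GL_n(𝔸_K) → ℂ` smooth in the archimedean
variable (`IsArchSmooth`: `Y ↦ φ (y · exp Y)` is `C^∞` on `𝔤` for every `y`), every `x` and every
invertible `m₀`, the function `F : m ↦ φ (x · u m)` is `C^∞` at `m₀`, and for `X ∈ 𝔤` its flat
derivative along `m₀ X` is the Lie derivative `(X φ)(x · m₀) = d/dt φ (x m₀ exp tX)|₀`.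

Proof.  Let `log` be a local logarithm on `M`, smooth on a neighbourhood of `1` with
`exp (log y) = y` near `1` (`exists_log_contDiffAt_nhds_one`).  For `m` near `m₀` the matrix
`y = m₀⁻¹ m` is near `1`, so `m = m₀ exp (log (m₀⁻¹ m))` is invertible and, as elements of `G_∞`,
`u m = m₀ · exp (log (m₀⁻¹ m))`; hence near `m₀`
`F m = Ψ (log (m₀⁻¹ m))` with `Ψ Y = φ ((x m₀) · exp Y)`, which is smooth on `𝔤 = M` by
`IsArchSmooth` at the point `x m₀`; the chain rule gives smoothness of `F` at `m₀`.  For the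
derivative, the curve `γ t = m₀ exp (tX)` has `γ 0 = m₀`, `γ' 0 = m₀ X`
(`hasDerivAt_exp_smul_const'`), and `u (γ t) = m₀ · exp (tX)` in `G_∞` for all `t`, so
`F ∘ γ = t ↦ φ (x m₀ exp tX)` exactly; by the chain rule
`D F(m₀)(m₀ X) = (F ∘ γ)'(0) = (X φ)(x m₀)`.

The statement is proved for the full linear group `GL N A` over any coefficient algebra `A` and
any chart `u` agreeing with `m ↦ m` on invertible matrices
(`contDiffAt_matrix_of_isArchSmooth_gl`), and specialised definitionally.
Borel–Jacquet 1979, §1.1 (smoothness in `x_∞`) and §1.5 (the action of `𝔤`).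
-/

set_option linter.dupNamespace false -- project-wide: `Summit.Langlands.Langlands` is the mandated namespace

noncomputable section

open scoped Matrix.Norms.Operator ContDiff Topology Matrix Classical
open Filter NumberField NumberField.mixedEmbedding
open Literature.NumberTheory.Automorphic Literature.NumberTheory.Automorphic.RealMatrixGroup

-- Mathlib idiom (as in `GKModules`/`ArchimedeanCalculus`): commutator bracket on matrix algebras
attribute [local instance 100] LieRing.ofAssociativeRing

namespace Summit.Langlands.Langlands.Theorems.HeckeEigenvalueField.Res

set_option backward.isDefEq.respectTransparency false in
/-- **Smoothness in matrix coordinates on `GL N A`.**  For the full linear real group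
`GL N A` (Lie algebra all of `M_N(A)`), a homomorphism `ι : GL N A → G`, a chart
`u : M_N(A) → GL N A` with `u m = m` on invertible matrices, `φ : G → ℂ` smooth in the archimedean
variable and `m₀` invertible: `m ↦ φ (x · ι (u m))` is `C^∞` at `m₀` (near `m₀`,
`u m = m₀ exp (log (m₀⁻¹ m))` for a local logarithm smooth near `1`), and its derivative along
`m₀ X` is the Lie derivative `(X φ)(x · ι m₀)` (chain rule along `t ↦ m₀ exp (tX)`).
Borel–Jacquet 1979, §1.1 and §1.5. [cite: BorelJacquet1979, §1.1, §1.5] -/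
private theorem contDiffAt_matrix_of_isArchSmooth_gl
    {A : Type*} [NormedCommRing A] [NormedAlgebra ℝ A] [NormedAlgebra ℚ A] [CompleteSpace A]
    [StarRing A] {N : Type*} [Fintype N] [DecidableEq N] {G : Type*} [Group G]
    (ι : (RealMatrixGroup.gl A N).carrier →* G)
    (u : Matrix N N A → (RealMatrixGroup.gl A N).carrier)
    (hu : ∀ (m : Matrix N N A) (h : IsUnit m), u m = ⟨h.unit, Subgroup.mem_top _⟩)
    {φ : G → ℂ} (hφ : IsArchSmooth ι φ) (x : G) {m₀ : Matrix N N A} (hm₀ : IsUnit m₀) :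
    ContDiffAt ℝ ∞ (fun m : Matrix N N A => φ (x * ι (u m))) m₀ ∧
      ∀ X : (RealMatrixGroup.gl A N).lie,
        fderiv ℝ (fun m : Matrix N N A => φ (x * ι (u m))) m₀ (m₀ * (X : Matrix N N A)) =
          lieDeriv ι X φ (x * ι ⟨hm₀.unit, Subgroup.mem_top _⟩) := by
  -- a local logarithm, smooth near `1`
  obtain ⟨log, hlogsm, hexplog, -⟩ := exists_log_contDiffAt_nhds_one (A := A) (N := N)
  -- `b = m₀⁻¹`
  obtain ⟨b, hbm, hmb⟩ : ∃ b : Matrix N N A, b * m₀ = 1 ∧ m₀ * b = 1 :=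
    ⟨↑hm₀.unit⁻¹, hm₀.val_inv_mul, hm₀.mul_val_inv⟩
  -- the Lie algebra is all of `M_N(A)`
  have hmem : ∀ m : Matrix N N A, m ∈ (RealMatrixGroup.gl A N).lie.toSubmodule := fun m =>
    LieSubalgebra.mem_top m
  -- the smooth model `m ↦ φ (x g₀ · exp (log (m₀⁻¹ m)))` of our function near `m₀`
  have hmodel : ContDiffAt ℝ ∞ (fun m : Matrix N N A =>
      φ ((x * ι ⟨hm₀.unit, Subgroup.mem_top _⟩) * ι ((RealMatrixGroup.gl A N).expMem
        ⟨log (b * m), hmem _⟩))) m₀ := by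
    have hlog : ContDiffAt ℝ ∞ (fun m : Matrix N N A => log (b * m)) m₀ := by
      have h1 : ContDiffAt ℝ ∞ log (b * m₀) := by
        rw [hbm]
        exact hlogsm.self_of_nhds
      exact h1.comp m₀ (contDiff_const.mul contDiff_id).contDiffAt
    have he : ContDiff ℝ ∞ (fun m : Matrix N N A =>
        (⟨m, hmem m⟩ : (RealMatrixGroup.gl A N).lie.toSubmodule)) :=
      ((ContinuousLinearMap.id ℝ (Matrix N N A)).codRestrict _ hmem).contDiff
    exact (hφ (x * ι ⟨hm₀.unit, Subgroup.mem_top _⟩)).contDiffAt.comp m₀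
      (he.contDiffAt.comp m₀ hlog)
  -- near `m₀`, `m₀⁻¹ m` is near `1`
  have htend : Tendsto (fun m : Matrix N N A => b * m) (𝓝 m₀) (𝓝 1) := by
    have h := (continuous_const_mul b).tendsto m₀
    rwa [hbm] at h
  -- key identity: if `exp (log (m₀⁻¹ m)) = m₀⁻¹ m` then `u m = m₀ · exp (log (m₀⁻¹ m))` in `GL N A`
  have hkey : ∀ m : Matrix N N A, NormedSpace.exp (log (b * m)) = b * m →
      u m = ⟨hm₀.unit, Subgroup.mem_top _⟩ *
        (RealMatrixGroup.gl A N).expMem ⟨log (b * m), hmem _⟩ := by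
    intro m hm
    have hm' : m = m₀ * NormedSpace.exp (log (b * m)) := by
      rw [hm, ← mul_assoc, hmb, one_mul]
    have hunit : IsUnit m := by
      rw [hm']
      exact hm₀.mul (Matrix.isUnit_exp _)
    rw [hu m hunit]
    refine Subtype.ext (Units.ext ?_)
    exact hm'
  have hev : (fun m : Matrix N N A => φ (x * ι (u m))) =ᶠ[𝓝 m₀] fun m : Matrix N N A =>
      φ ((x * ι ⟨hm₀.unit, Subgroup.mem_top _⟩) * ι ((RealMatrixGroup.gl A N).expMem
        ⟨log (b * m), hmem _⟩)) := by
    filter_upwards [htend.eventually hexplog] with m hm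
    rw [hkey m hm, map_mul, mul_assoc]
  have hF : ContDiffAt ℝ ∞ (fun m : Matrix N N A => φ (x * ι (u m))) m₀ :=
    hmodel.congr_of_eventuallyEq hev
  refine ⟨hF, fun X => ?_⟩
  -- the derivative along `m₀ X`: differentiate along the curve `t ↦ m₀ exp (t X)`
  have hγd : HasDerivAt (fun t : ℝ => m₀ * NormedSpace.exp (t • (X : Matrix N N A)))
      (m₀ * (X : Matrix N N A)) 0 := by
    have h := (hasDerivAt_exp_smul_const' (𝕂 := ℝ) (X : Matrix N N A) (0 : ℝ)).const_mul m₀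
    simp only [zero_smul, NormedSpace.exp_zero, mul_one] at h
    exact h
  have hγu : ∀ t : ℝ, u (m₀ * NormedSpace.exp (t • (X : Matrix N N A))) =
      ⟨hm₀.unit, Subgroup.mem_top _⟩ * (RealMatrixGroup.gl A N).expMem (t • X) := by
    intro t
    rw [hu _ (hm₀.mul (Matrix.isUnit_exp _))]
    refine Subtype.ext (Units.ext ?_)
    rfl
  have hcomp : ((fun m : Matrix N N A => φ (x * ι (u m))) ∘ fun t : ℝ =>
      m₀ * NormedSpace.exp (t • (X : Matrix N N A))) = fun t : ℝ =>
        φ ((x * ι ⟨hm₀.unit, Subgroup.mem_top _⟩) *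
          ι ((RealMatrixGroup.gl A N).expMem (t • X))) := by
    funext t
    simp only [Function.comp_apply, hγu t, map_mul, mul_assoc]
  have h0 : m₀ = (fun t : ℝ => m₀ * NormedSpace.exp (t • (X : Matrix N N A))) 0 := by
    simp only [zero_smul, NormedSpace.exp_zero, mul_one]
  have hchain :=
    (((hF.differentiableAt (by simp)).hasFDerivAt).comp_hasDerivAt_of_eq (0 : ℝ) hγd h0).deriv
  rw [hcomp] at hchain
  rw [← hchain]
  rfl

/-- **Stub DICT-W4 (archimedean calculus): automorphic forms are smooth in the matrix coordinates of
`G_∞`, and the flat derivative along `m₀ X` is the Lie derivative.**  For `φ` smooth in the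
archimedean variable (`IsArchSmooth`: `X ↦ φ (y · exp X)` smooth on `𝔤` for every `y`) and an
invertible `m₀ ∈ M_n(K_∞)`, the function `m ↦ φ (x · m)` (the matrix `m` read in `G_∞ = GL_n(K_∞)`,
junk `1` off the invertible matrices) is smooth at `m₀`, with derivative along `m₀ X` equal to
`(X φ)(x · m₀)` (local logarithm at `1`: `m = m₀ exp(log(m₀⁻¹ m))`, `exists_log_contDiffAt_nhds_one`).
Borel–Jacquet 1979, §1.1 and §1.5. [cite: BorelJacquet1979, §1.1, §1.5] -/
theorem stub_isArchSmooth_contDiffAt_matrix {n : ℕ} {K : Type} [Field K] [NumberField K]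
    (hcpt : isCompact_glFiniteIntegralLevel n K) {φ : (AdelicGroupData.gl n K).Adelic → ℂ}
    (hφ : IsArchSmooth (AutomorphyDatum.gl n K hcpt).ofArch φ) (x : (AdelicGroupData.gl n K).Adelic)
    {m₀ : Matrix (Fin n) (Fin n) (mixedSpace K)} (hm₀ : IsUnit m₀) :
    ContDiffAt ℝ ∞ (fun m : Matrix (Fin n) (Fin n) (mixedSpace K) =>
        φ (x * (AutomorphyDatum.gl n K hcpt).ofArch
          (if h : IsUnit m then ⟨h.unit, Subgroup.mem_top _⟩ else 1))) m₀ ∧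
      ∀ X : (AutomorphyDatum.gl n K hcpt).arch.lie,
        fderiv ℝ (fun m : Matrix (Fin n) (Fin n) (mixedSpace K) =>
            φ (x * (AutomorphyDatum.gl n K hcpt).ofArch
              (if h : IsUnit m then ⟨h.unit, Subgroup.mem_top _⟩ else 1))) m₀
            (m₀ * (X : Matrix (Fin n) (Fin n) (mixedSpace K))) =
          lieDeriv (AutomorphyDatum.gl n K hcpt).ofArch X φ
            (x * (AutomorphyDatum.gl n K hcpt).ofArch ⟨hm₀.unit, Subgroup.mem_top _⟩) := by
  exact contDiffAt_matrix_of_isArchSmooth_gl (AutomorphyDatum.gl n K hcpt).ofArch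
    (fun m => if h : IsUnit m then ⟨h.unit, Subgroup.mem_top _⟩ else 1) (fun _ h => dif_pos h)
    hφ x hm₀

end Summit.Langlands.Langlands.Theorems.HeckeEigenvalueField.Res

end
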